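import Summits.ResolutionOfSingularities.ResolutionOfSingularities.Theorems.EquisingularLiftEquisingularLiftNatHypersurfaceLinearCentreBlowup
import Literature.AlgebraicGeometry.Resolution.MonomialOrderReductionUnit
import HarnessLib

/-!
# [OURS · L1 W4.5(b)] COORDINATE LINEAR CENTRES ON A HYPERSURFACE, ANY DIMENSION — LOCAL FORM: regularity of the blow-up from the chart rings
# AT THE EXCEPTIONAL DIVISOR and regularity of `H` off the centre (crux `Theses.EquisingularLift.EquisingularLiftNat`, stmt-ResolutionOfSingularities-20038)

NOT a statement of any manuscript; OURS kernel plumbing (cell `res-hironaka`, chain w45b; seat res-D-pv-013, own initiative, counted 0). AI-written,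
weaker than expert review. No definition, no `sorry`, standard axioms.

Sharpening of `HypersurfaceSpecimen.isRegular_of_isBlowup_comap_of_charts` (p535275), which asked the affine blow-up algebras
`(ChartRing F c)[I_c/(x_a/x_c)]` to be regular RINGS: for a centre that is the singular locus of `H` only LOCALLY (an isolated singular point that is not a
cone vertex, …) one knows regularity of those algebras only at the primes ON the exceptional divisor (`x_a/x_c ∈ 𝔐`), the remaining points being
points of `H` off the centre, where the blow-up is a local isomorphism (`IsBlowup.isIso_stalkMap_of_not_mem_support`).

* **`HypersurfaceSpecimen.isRegular_of_isBlowup_comap_of_charts_local`** — `F ∈ k[x₀,…,x_{n+1}]` homogeneous of positive degree, `H = V₊(F)`,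
  `e : Fin (r+1) → Fin (n+2)` injective (surviving variables), `Λ = ker Proj(f_k)` the coordinate `ℙʳ`. If `H` is regular at every point `x` with
  `ι(x) ∉ supp Λ`, and for `c ∈ range e`, `a ∉ range e` the localisations of `(ChartRing F c)[I_c/(x_a/x_c)]` at the primes containing `x_a/x_c` are
  regular, then EVERY blow-up of `H` along `Λ·𝒪_H` is a regular scheme.

References: The Stacks Project 0804, 02OS — through the cited tree files.
-/

set_option linter.dupNamespace false -- mandated namespace `Summit.<Summit>.<Problem>` of this single-conjunct summit

noncomputable section

open CategoryTheory CategoryTheory.Limits AlgebraicGeometry TopologicalSpace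
open MvPolynomial HomogeneousLocalization
open Literature.AlgebraicGeometry.Resolution
open Literature.AlgebraicGeometry.Motives Literature.AlgebraicGeometry.Motives.SmoothHypersurface
open Literature.AlgebraicGeometry.Motives.ProjectiveSpace
open AlgebraicGeometry.Scheme.IdealSheafData
open Summit.ResolutionOfSingularities.ResolutionOfSingularities.Cruxes.EquisingularLift.StrataSplit

namespace Summit.ResolutionOfSingularities.ResolutionOfSingularities.Cruxes.EquisingularLiftNat.Sections

attribute [local instance] MvPolynomial.gradedAlgebra ProjBaseChange.algebraBase

namespace HypersurfaceSpecimen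

variable (k : Type) [Field k] {n : ℕ} (F : MvPolynomial (Fin (n + 2)) k) {d : ℕ} (hF : F.IsHomogeneous d) (hd : 0 < d)
  {r : ℕ} (e : Fin (r + 1) → Fin (n + 2)) (he : Function.Injective e)
  (fk : homogeneousSubmodule (Fin (n + 2)) k →+*ᵍ homogeneousSubmodule (Fin (r + 1)) k)
  (hfk' : HomogeneousIdeal.irrelevant (homogeneousSubmodule (Fin (r + 1)) k) ≤
    (HomogeneousIdeal.irrelevant (homogeneousSubmodule (Fin (n + 2)) k)).map fk)
  (hfkC : ∀ a : k, fk (C a) = C a) (hfke : ∀ j : Fin (r + 1), fk (X (e j)) = X j)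
  (hfk0 : ∀ i : Fin (n + 2), i ∉ Set.range e → fk (X i) = 0)

include hd he hfkC hfke hfk0 in
/-- **REGULARITY OF THE BLOW-UP OF A HYPERSURFACE ALONG A COORDINATE LINEAR SUBSPACE — LOCAL FORM** (any `n`, any `e`): if `H = V₊(F)` is regular
at every point off `supp Λ` and, for `c ∈ range e` and `a ∉ range e`, the localisations of the affine blow-up algebra `(ChartRing F c)[I_c/(x_a/x_c)]`,
`I_c = (x_{a'}/x_c : a' ∉ range e)`, at its primes CONTAINING `x_a/x_c` (the points of the exceptional divisor of that chart) are regular, then every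
blow-up `ρ : Z → H` along `Λ·𝒪_H` is a regular scheme. Off `supp(Λ·𝒪_H)` the blow-up is a local isomorphism
(`IsBlowup.isIso_stalkMap_of_not_mem_support`); over it, `ρ z` lies in a chart `D₊(x_c)` with `c ∈ range e` (the killed variables vanish on
`supp Λ`), `z` lies in a chart `Spec (ChartRing F c)[I_c/(x_a/x_c)]` at a generator (Stacks 0804), at a prime containing `x_a/x_c` because its image
in `Spec (ChartRing F c)` lies on `V(I_c)`. [cite: StacksProject, Tag 0804] -/
theorem isRegular_of_isBlowup_comap_of_charts_local
    (hoff : ∀ x : (hypersurface F).left, (hypersurfaceι F).left x ∉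
      ((Proj.map fk hfk').ker.support : Set (Proj (homogeneousSubmodule (Fin (n + 2)) k))) →
      IsRegularLocalRing ((hypersurface F).left.presheaf.stalk x))
    (hon : ∀ c : Fin (n + 2), c ∈ Set.range e → ∀ (a : {a : Fin (n + 2) // a ∉ Set.range e})
      (𝔐 : Ideal (blowupAlgebra (Ideal.span (Set.range fun a' : {a' : Fin (n + 2) // a' ∉ Set.range e} => tautVec F c hF a'.1))
        (tautVec F c hF a.1))) [𝔐.IsPrime],
      algebraMap (ChartRing F c hF) (blowupAlgebra (Ideal.span (Set.range fun a' : {a' : Fin (n + 2) // a' ∉ Set.range e} =>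
        tautVec F c hF a'.1)) (tautVec F c hF a.1)) (tautVec F c hF a.1) ∈ 𝔐 →
      IsRegularLocalRing (Localization.AtPrime 𝔐))
    (Z : Scheme.{0}) (ρ : Z ⟶ (hypersurface F).left) (hρ : IsBlowup ρ ((Proj.map fk hfk').ker.comap (hypersurfaceι F).left)) :
    Scheme.IsRegular Z := by
  intro z
  -- off the centre the blow-up is a local isomorphism
  by_cases hzs : ρ z ∈ (((Proj.map fk hfk').ker.comap (hypersurfaceι F).left).support : Set (hypersurface F).left)
  swap
  · haveI := hρ.isIso_stalkMap_of_not_mem_support hzs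
    have hι : (hypersurfaceι F).left (ρ z) ∉ ((Proj.map fk hfk').ker.support : Set (Proj (homogeneousSubmodule (Fin (n + 2)) k))) := by
      intro h
      apply hzs
      rw [Scheme.IdealSheafData.support_comap]
      exact h
    haveI := hoff (ρ z) hι
    exact IsRegularLocalRing.of_ringEquiv (R := (hypersurface F).left.presheaf.stalk (ρ z))
      (asIso (ρ.stalkMap z)).commRingCatIsoToRingEquiv
  -- over the centre: `ρ z ∈ D₊(x_c)` for some SURVIVING `c`
  have hιs : (hypersurfaceι F).left (ρ z) ∈ ((Proj.map fk hfk').ker.support : Set (Proj (homogeneousSubmodule (Fin (n + 2)) k))) := by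
    rw [Scheme.IdealSheafData.support_comap] at hzs
    exact hzs
  obtain ⟨c, hc⟩ := exists_mem_coordChartOpen ((hypersurfaceι F).left (ρ z))
  have hce : c ∈ Set.range e := by
    by_contra hce
    exact (Proj.mem_basicOpen _ _ _).mp hc (LinearCentre.X_mem_asHomogeneousIdeal_of_mem_support e fk hfk' hfkC hfke hfk0 hιs hce)
  let U : (hypersurface F).left.Opens := (hypersurfaceι F).left ⁻¹ᵁ Proj.basicOpen (homogeneousSubmodule (Fin (n + 2)) k) (X c)
  have hzU : ρ z ∈ U := hc
  have hrange : Set.range (chart F c hF hd).left = Set.range U.ι := by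
    rw [range_chart_left, Scheme.Opens.range_ι]
  let ee := IsOpenImmersion.isoOfRangeEq (chart F c hF hd).left U.ι hrange
  have hee : ee.hom ≫ U.ι = (chart F c hF hd).left := IsOpenImmersion.isoOfRangeEq_hom_fac _ _ _
  have hee' : ∀ u, (chart F c hF hd).left (ee.inv u) = U.ι u := by
    intro u
    have h1 : ee.hom (ee.inv u) = u := by
      rw [← Scheme.Hom.comp_apply, ee.inv_hom_id]
      rfl
    rw [← hee, Scheme.Hom.comp_apply, h1]
  -- the restricted blow-up, moved to `Spec (ChartRing F c)`
  set I : Ideal (ChartRing F c hF) := Ideal.span (Set.range fun a : {a : Fin (n + 2) // a ∉ Set.range e} => tautVec F c hF a.1) with hI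
  have hρU0 : IsBlowup ((ρ ∣_ U) ≫ ee.symm.hom) ((((Proj.map fk hfk').ker.comap (hypersurfaceι F).left)).comap (chart F c hF hd).left) := by
    have h := (hρ.restrict U).comp_iso ee.symm
    rw [← Scheme.IdealSheafData.comap_comp, Iso.symm_inv, hee] at h
    exact h
  have hρU : IsBlowup ((ρ ∣_ U) ≫ ee.symm.hom) (ofIdealTop (I.map (Scheme.ΓSpecIso (CommRingCat.of (ChartRing F c hF))).inv.hom)) :=
    WhitneyCubic.isBlowup_of_ideal_eq hρU0 (comap_chart_eq_ofIdealTop k F hF hd e he fk hfk' hfkC hfke hfk0 c)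
  -- the image of `z` in `Spec (ChartRing F c)` lies on `V(I)`
  have hy : ((ρ ∣_ U) ≫ ee.symm.hom) ⟨z, hzU⟩ ∈
      ((ofIdealTop (I.map (Scheme.ΓSpecIso (CommRingCat.of (ChartRing F c hF))).inv.hom)).support :
        Set (Spec (CommRingCat.of (ChartRing F c hF)))) := by
    rw [← comap_chart_eq_ofIdealTop k F hF hd e he fk hfk' hfkC hfke hfk0 c, Scheme.IdealSheafData.support_comap]
    change (chart F c hF hd).left (ee.inv ((ρ ∣_ U) ⟨z, hzU⟩)) ∈
      ((((Proj.map fk hfk').ker.comap (hypersurfaceι F).left)).support : Set (hypersurface F).left)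
    rw [hee', ← Scheme.Hom.comp_apply, morphismRestrict_ι]
    exact hzs
  -- the stalk of `Z` at `z` is the stalk of the open piece `ρ⁻¹ U` at `⟨z, _⟩`
  haveI : IsIso ((ρ ⁻¹ᵁ U).ι.stalkMap ⟨z, hzU⟩) := inferInstance
  suffices hst : IsRegularLocalRing ((↑(ρ ⁻¹ᵁ U) : Scheme.{0}).presheaf.stalk ⟨z, hzU⟩) from by
    haveI := hst
    exact IsRegularLocalRing.of_ringEquiv (asIso ((ρ ⁻¹ᵁ U).ι.stalkMap ⟨z, hzU⟩)).commRingCatIsoToRingEquiv.symm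
  -- a chart at a generator through `z`
  obtain ⟨j, φ, hφ, hzφ, hφρ⟩ := IsBlowup.exists_chart_of_span_range_eq hρU
    (fun a : {a : Fin (n + 2) // a ∉ Set.range e} => tautVec F c hF a.1) rfl ⟨z, hzU⟩
  obtain ⟨w, hw⟩ := hzφ
  -- `x_j/x_c ∈ w`: the image of `w` in `Spec (ChartRing F c)` lies on `V(I)` and `x_j/x_c ∈ I`
  have hbw : algebraMap (ChartRing F c hF) (blowupAlgebra I (tautVec F c hF j.1)) (tautVec F c hF j.1) ∈ w.asIdeal := by
    have hyw : ((ρ ∣_ U) ≫ ee.symm.hom) ⟨z, hzU⟩ =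
        Spec.map (CommRingCat.ofHom (algebraMap (ChartRing F c hF) (blowupAlgebra I (tautVec F c hF j.1)))) w := by
      rw [← hw]
      exact congrArg (fun f => f w) hφρ
    have hy' := hy
    rw [hyw, Scheme.IdealSheafData.coe_support_ofIdealTop, Spec_zeroLocus, Spec.map_apply] at hy'
    have hmem : tautVec F c hF j.1 ∈ (Scheme.ΓSpecIso (CommRingCat.of (ChartRing F c hF))).inv ⁻¹'
        (I.map (Scheme.ΓSpecIso (CommRingCat.of (ChartRing F c hF))).inv.hom : Set _) :=
      Ideal.mem_map_of_mem _ (Ideal.subset_span ⟨j, rfl⟩)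
    have h := (PrimeSpectrum.mem_zeroLocus _ _).mp hy' hmem
    rw [PrimeSpectrum.comap_asIdeal] at h
    exact h
  haveI := hon c hce j w.asIdeal hbw
  by_contra hz
  rw [← hw] at hz
  exact not_isRegularLocalRing_localization_of_stalk φ w hz inferInstance

end HypersurfaceSpecimen

end Summit.ResolutionOfSingularities.ResolutionOfSingularities.Cruxes.EquisingularLiftNat.Sections

end
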